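import Summits.AtomisticToContinuum.HydrodynamicLimit.Theorems.JParityClosureRateFloorPerParticleFreeStretch
import Summits.AtomisticToContinuum.HydrodynamicLimit.Theorems.JParityClosureRateFloorWouldBeRealised
import Summits.AtomisticToContinuum.HydrodynamicLimit.Theorems.JParityClosureRateFloorWindowPreemption
import Literature.Analysis.FluidPDE.HardSphereRegularGeometry

/-!
# Marked realised transfer (`stub_markedTransfer`, registered stub S6d of the line `Sketch`
# of the crux `JParityClosure.RateFloor`, stmt-AtomisticToContinuum-13080)

Helper file (`--supports stmt-AtomisticToContinuum-13080`) discharging the registered stub S6d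
`stub_markedTransfer` of the lead's skeleton for the crux `JParityClosure.RateFloor`, line
`Sketch`, stated exactly as registered: one antecedent, the text of the neighbouring stub S6a
(realised datum: a would-be pair realised at the end of a window during which neither endpoint
collides enters the collision functional with the free-flight-predicted datum), then the
conclusion.

**Statement.**  On a hard-sphere trajectory `γ` on `𝕋³` with diameter `0 < ε < 1/2`, fix a window
`(s, t]`, a nonnegative mark `F u x y v w`, and for every ordered pair `p = (i, j)` the first
near-contact time `t₁ p = inf {u ∈ (0, t − s] | ‖xᵢ(u) − xⱼ(u)‖ ≤ ε}` of the free flights issued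
from `γ s`.  Let `R` be the REALISED would-be pairs: `i ≠ j`, the free flights come within `ε` at
some time of `(0, t − s]`, and neither `i` nor `j` takes part in a collision during
`(s, s + t₁ p)`.  Then the marks of the pairs of `R`, read at the predicted datum
`(s + t₁ p, free-flight positions at t₁ p, vᵢ(s), vⱼ(s))`, sum to at most the collision
functional of the window with the same mark,
`∑ᶠ_{u ∈ collisionTimes ∩ (s, t]} ∑ᵢ ∑ⱼ 1[i ≠ j, ‖xᵢ(u) − xⱼ(u)‖ = ε] F u xᵢ(u) xⱼ(u) pv.1 pv.2`,
`pv` the current velocities reflected across the separation vector.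

**Proof.**  (1) `first_contact`: for `p ∈ R` the set `D` of near-contact times is nonempty, the
pair distance along the free flights is continuous and `> ε` on a short initial interval
`(0, δ)` (`RateFloorWindowPreemption.exists_sep_window`), so `D ⊆ [δ, t − s]` is closed,
`t₁ p = inf D ∈ D` (`IsClosed.csInf_mem`), and the distance at `t₁ p` is exactly `ε` (it is `ε`
somewhere on `[δ/2, t₁ p]` by the intermediate value theorem, at a point of `D`, hence at
`t₁ p` by minimality).  (2) Neither endpoint collides during `(s, s + t₁ p)`, so by the
per-particle free stretch S1 (`RateFloorPerParticleFreeStretch.stub_perParticleFreeStretch`) and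
continuity of positions (`RateFloorWouldBeRealised.apply_fst_eq_freeFlight_of_forall_Ico`) the
positions at `u_p := s + t₁ p` are the free-flight positions, in contact; so `u_p ∈ (s, t]` is a
collision time, `(i, j)` an ordered contact pair there, and by the antecedent S6a the reflected
current velocities are `(vᵢ(s), vⱼ(s))`: the predicted term of `p` IS the summand of the
right-hand side at `(u_p, i, j)`.  (3) `sum_le_sum_sum_sum`: distinct pairs give distinct
indices `(u_p, p)`, all summands are `≥ 0`, and the `finsum` over the finitely many collision
times of `(s, t]` (`IsHardSphereTrajectory.finite_collisionTimes_inter_of_subset_Icc`) is a finite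
sum (`finsum_mem_eq_finite_toFinset_sum`, `Finset.single_le_sum`, `Finset.sum_comm`).

References: Gallagher–Saint-Raymond–Texier 2013 §4.1 (hard-sphere trajectories); elementary.
-/

noncomputable section

open scoped Classical BigOperators

namespace Summit.AtomisticToContinuum.HydrodynamicLimit.Theorems

open MeasureTheory Set Filter Topology
open Literature.Analysis.FluidPDE Literature.MathematicalPhysics.KineticTheory

namespace RateFloorMarkedTransfer

/-! ### First contact time as an infimum -/

/-- **The first near-contact time is a contact time.**  If a continuous real function `d`
exceeds `ε` on a short interval `(0, δ)` and is `≤ ε` somewhere in `(0, T]`, then the infimum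
`τ` of the near-contact times `{u ∈ (0, T] | d u ≤ ε}` lies in `(0, T]` and `d τ = ε` (the set is
closed and bounded below by `δ`, so it contains its infimum; `d` takes the value `ε` on
`[δ/2, τ]` at a point of the set, which by minimality is `τ`). [folklore] -/
theorem first_contact {d : ℝ → ℝ} (hd : Continuous d) {T ε δ : ℝ} (hδ : 0 < δ)
    (hsep : ∀ u ∈ Set.Ioo 0 δ, ε < d u) (hex : ∃ u ∈ Set.Ioc 0 T, d u ≤ ε) {τ : ℝ}
    (hτ : τ = sInf {u : ℝ | u ∈ Set.Ioc 0 T ∧ d u ≤ ε}) :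
    τ ∈ Set.Ioc 0 T ∧ d τ = ε := by
  -- every near-contact time is `≥ δ`: the set of near-contact times is closed and bounded below
  have hδle : ∀ u ∈ {u : ℝ | u ∈ Set.Ioc 0 T ∧ d u ≤ ε}, δ ≤ u := fun u hu =>
    not_lt.1 fun hlt => (hsep u ⟨hu.1.1, hlt⟩).not_ge hu.2
  have hbdd : BddBelow {u : ℝ | u ∈ Set.Ioc 0 T ∧ d u ≤ ε} := ⟨δ, hδle⟩
  have hclosed : IsClosed {u : ℝ | u ∈ Set.Ioc 0 T ∧ d u ≤ ε} := by
    have hDeq : {u : ℝ | u ∈ Set.Ioc 0 T ∧ d u ≤ ε} = Set.Icc δ T ∩ {u | d u ≤ ε} :=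
      Set.ext fun u => ⟨fun hu => ⟨⟨hδle u hu, hu.1.2⟩, hu.2⟩,
        fun hu => ⟨⟨hδ.trans_le hu.1.1, hu.1.2⟩, hu.2⟩⟩
    rw [hDeq]
    exact isClosed_Icc.inter (isClosed_le hd continuous_const)
  have hmem : τ ∈ {u : ℝ | u ∈ Set.Ioc 0 T ∧ d u ≤ ε} := by
    rw [hτ]
    exact hclosed.csInf_mem hex hbdd
  refine ⟨hmem.1, ?_⟩
  -- `d` takes the value `ε` on `[δ/2, τ]`, at a near-contact time, which by minimality is `τ`
  have hlt : ε < d (δ / 2) := hsep (δ / 2) ⟨by linarith, by linarith⟩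
  have hδτ : δ / 2 ≤ τ := by linarith [hδle τ hmem]
  obtain ⟨c, hc, hcε⟩ := intermediate_value_Icc' hδτ hd.continuousOn ⟨hmem.2, hlt.le⟩
  have hcD : c ∈ {u : ℝ | u ∈ Set.Ioc 0 T ∧ d u ≤ ε} :=
    ⟨⟨by linarith [hc.1], hc.2.trans hmem.1.2⟩, hcε.le⟩
  have hτc : τ ≤ c := by
    rw [hτ]
    exact csInf_le hbdd hcD
  obtain rfl : c = τ := le_antisymm hc.2 hτc
  exact hcε

/-! ### Positions of an undeflected particle -/

/-- **Positions of an undeflected particle are free-flight positions.**  On a hard-sphere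
trajectory on `𝕋³`, if particle `k` takes part in no collision during `(s, s + τ)` (`τ > 0`),
then its POSITION at time `s + τ` is the position of its free flight issued from `γ s` after
time `τ` (S1 `RateFloorPerParticleFreeStretch.stub_perParticleFreeStretch` on `[s, s + τ)`, then
continuity of positions, `RateFloorWouldBeRealised.apply_fst_eq_freeFlight_of_forall_Ico`).
[folklore] -/
theorem apply_fst_eq_freeFlight_of_not_participates {N : ℕ} {ε : ℝ}
    {γ : ℝ → Config N (Fin 3) T3} (h : IsHardSphereTrajectory (Torus.geometry (Fin 3)) ε N γ)
    {s τ : ℝ} (hτ : 0 < τ) {k : Fin N}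
    (hk : ∀ u ∈ Set.Ioo s (s + τ), ¬ Participates (Torus.geometry (Fin 3)) ε (γ u) k) :
    (γ (s + τ) k).1 = (freeFlight (Torus.geometry (Fin 3)) τ (γ s) k).1 := by
  have hfree : ∀ u ∈ Ico s (s + τ),
      γ u k = freeFlight (Torus.geometry (Fin 3)) (u - s) (γ s) k := fun u hu =>
    RateFloorPerParticleFreeStretch.stub_perParticleFreeStretch N ε γ h s u k hu.1
      fun w hw hmem => hk w ⟨hw.1, hw.2.trans_lt hu.2⟩ (mem_collisionTimesOf.1 hmem)
  have heq := RateFloorWouldBeRealised.apply_fst_eq_freeFlight_of_forall_Ico (h.pos_continuous k)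
    (show s < s + τ by linarith) hfree
  rwa [add_sub_cancel_left] at heq

/-! ### Summation over realised pairs -/

/-- **Injective transfer of nonnegative terms.**  If every `p ∈ R` is sent to an index
`u p ∈ T` and its term `a p` equals the `(u p, p)`-summand of a nonnegative triple sum over
`T × ι₁ × ι₂`, then `∑_{p ∈ R} a p` is at most the triple sum (distinct pairs give distinct
indices). [folklore] -/
theorem sum_le_sum_sum_sum {ι₁ ι₂ κ : Type*} [Fintype ι₁] [Fintype ι₂] (R : Finset (ι₁ × ι₂))
    (T : Finset κ) {g : κ → ι₁ → ι₂ → ℝ} (hg : ∀ v i j, 0 ≤ g v i j) {a : ι₁ × ι₂ → ℝ}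
    (u : ι₁ × ι₂ → κ) (hu : ∀ p ∈ R, u p ∈ T) (ha : ∀ p ∈ R, a p = g (u p) p.1 p.2) :
    ∑ p ∈ R, a p ≤ ∑ v ∈ T, ∑ i, ∑ j, g v i j :=
  calc ∑ p ∈ R, a p = ∑ p ∈ R, g (u p) p.1 p.2 := Finset.sum_congr rfl ha
    _ ≤ ∑ p ∈ R, ∑ v ∈ T, g v p.1 p.2 :=
        Finset.sum_le_sum fun (p : ι₁ × ι₂) hp =>
          Finset.single_le_sum (f := fun v => g v p.1 p.2) (fun v _ => hg v p.1 p.2) (hu p hp)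
    _ ≤ ∑ p : ι₁ × ι₂, ∑ v ∈ T, g v p.1 p.2 :=
        Finset.sum_le_univ_sum_of_nonneg fun (p : ι₁ × ι₂) =>
          Finset.sum_nonneg fun v _ => hg v p.1 p.2
    _ = ∑ v ∈ T, ∑ p : ι₁ × ι₂, g v p.1 p.2 := Finset.sum_comm
    _ = ∑ v ∈ T, ∑ i, ∑ j, g v i j :=
        Finset.sum_congr rfl fun v _ => Fintype.sum_prod_type' (g v)

/-! ### The stub -/

/-- **S6d · marked realised transfer** (registered stub `stub_markedTransfer` of the line
`Sketch` for `JParityClosure.RateFloor`, stmt-AtomisticToContinuum-13080, verbatim).  Given the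
realised-datum property (the text of the neighbouring stub S6a) as hypothesis: on a hard-sphere
trajectory on `𝕋³` with `0 < ε < 1/2` and a window `(s, t]`, for a nonnegative mark `F`, the
marks of the REALISED would-be pairs `R` (would-be, neither endpoint deflected before the first
contact time `t₁ p` of the free flights), read at the free-flight-predicted datum, sum to at most
the collision functional of the window with the same mark: every `p ∈ R` collides at
`s + t₁ p ∈ (s, t]` and contributes there exactly its predicted term (`first_contact`,
`apply_fst_eq_freeFlight_of_not_participates`, S6a), distinct pairs give distinct indices, and
the other summands are `≥ 0` (`sum_le_sum_sum_sum`). [folklore] -/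
theorem stub_markedTransfer :
    (∀ (N : ℕ) (ε : ℝ) (γ : ℝ → Config N (Fin 3) T3),
    IsHardSphereTrajectory (Torus.geometry (Fin 3)) ε N γ → 0 < ε → ε < 2⁻¹ →
    ∀ (s t : ℝ) (i j : Fin N), s < t → i ≠ j →
      (∀ u ∈ Set.Ioo s t, u ∉ collisionTimesOf (Torus.geometry (Fin 3)) ε γ i) →
      (∀ u ∈ Set.Ioo s t, u ∉ collisionTimesOf (Torus.geometry (Fin 3)) ε γ j) →
      ‖(Torus.geometry (Fin 3)).sepVec (freeFlight (Torus.geometry (Fin 3)) (t - s) (γ s) i).1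
          (freeFlight (Torus.geometry (Fin 3)) (t - s) (γ s) j).1‖ = ε →
      (Torus.geometry (Fin 3)).sepVec (γ t i).1 (γ t j).1 =
          (Torus.geometry (Fin 3)).sepVec (freeFlight (Torus.geometry (Fin 3)) (t - s) (γ s) i).1
            (freeFlight (Torus.geometry (Fin 3)) (t - s) (γ s) j).1 ∧
        reflectVel ((Torus.geometry (Fin 3)).sepVec (γ t i).1 (γ t j).1) ((γ t i).2, (γ t j).2) =
          ((γ s i).2, (γ s j).2)) →
    ∀ (N : ℕ) (ε : ℝ) (γ : ℝ → Config N (Fin 3) T3),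
    IsHardSphereTrajectory (Torus.geometry (Fin 3)) ε N γ → 0 < ε → ε < 2⁻¹ →
    ∀ (s t : ℝ), s < t →
      ∀ (F : ℝ → T3 → T3 → V3 → V3 → ℝ), (∀ u x y v w, 0 ≤ F u x y v w) →
      ∀ (t₁ : Fin N × Fin N → ℝ),
      (∀ p, t₁ p = sInf {u : ℝ | u ∈ Set.Ioc 0 (t - s) ∧ ‖(Torus.geometry (Fin 3)).sepVec
          (freeFlight (Torus.geometry (Fin 3)) u (γ s) p.1).1 (freeFlight (Torus.geometry (Fin 3)) u (γ s) p.2).1‖ ≤ ε}) →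
      ∀ (R : Finset (Fin N × Fin N)),
      (R = Finset.univ.filter fun p => p.1 ≠ p.2 ∧
        (∃ u ∈ Set.Ioc 0 (t - s), ‖(Torus.geometry (Fin 3)).sepVec
          (freeFlight (Torus.geometry (Fin 3)) u (γ s) p.1).1 (freeFlight (Torus.geometry (Fin 3)) u (γ s) p.2).1‖ ≤ ε) ∧
        (∀ u ∈ Set.Ioo s (s + t₁ p), ¬ Participates (Torus.geometry (Fin 3)) ε (γ u) p.1) ∧
        (∀ u ∈ Set.Ioo s (s + t₁ p), ¬ Participates (Torus.geometry (Fin 3)) ε (γ u) p.2)) →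
      ∑ p ∈ R, F (s + t₁ p) (freeFlight (Torus.geometry (Fin 3)) (t₁ p) (γ s) p.1).1 (freeFlight (Torus.geometry (Fin 3)) (t₁ p) (γ s) p.2).1
          ((γ s p.1).2) ((γ s p.2).2) ≤
        ∑ᶠ (u : ℝ) (_ : u ∈ collisionTimes (Torus.geometry (Fin 3)) ε γ ∩ Set.Ioc s t),
          ∑ i : Fin N, ∑ j : Fin N,
            (if i ≠ j ∧ ‖(Torus.geometry (Fin 3)).sepVec (γ u i).1 (γ u j).1‖ = ε then
              F u (γ u i).1 (γ u j).1
                (reflectVel ((Torus.geometry (Fin 3)).sepVec (γ u i).1 (γ u j).1) ((γ u i).2, (γ u j).2)).1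
                (reflectVel ((Torus.geometry (Fin 3)).sepVec (γ u i).1 (γ u j).1) ((γ u i).2, (γ u j).2)).2
            else 0) := by
  intro hS6a N ε γ h hε hε2 s t _hst F hF t₁ ht₁ R hR
  have hG : (Torus.geometry (Fin 3)).IsHardSphereRegular ε := Torus.isHardSphereRegular_geometry hε2
  -- (1)-(2) every realised would-be pair `p` collides at `s + t₁ p ∈ (s, t]` and its predicted
  -- term is the summand of the right-hand side at `(s + t₁ p, p)`
  have key : ∀ p ∈ R,
      s + t₁ p ∈ collisionTimes (Torus.geometry (Fin 3)) ε γ ∩ Set.Ioc s t ∧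
      F (s + t₁ p) (freeFlight (Torus.geometry (Fin 3)) (t₁ p) (γ s) p.1).1
          (freeFlight (Torus.geometry (Fin 3)) (t₁ p) (γ s) p.2).1 ((γ s p.1).2) ((γ s p.2).2) =
        (if p.1 ≠ p.2 ∧ ‖(Torus.geometry (Fin 3)).sepVec (γ (s + t₁ p) p.1).1
            (γ (s + t₁ p) p.2).1‖ = ε then
          F (s + t₁ p) (γ (s + t₁ p) p.1).1 (γ (s + t₁ p) p.2).1
            (reflectVel ((Torus.geometry (Fin 3)).sepVec (γ (s + t₁ p) p.1).1
              (γ (s + t₁ p) p.2).1) ((γ (s + t₁ p) p.1).2, (γ (s + t₁ p) p.2).2)).1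
            (reflectVel ((Torus.geometry (Fin 3)).sepVec (γ (s + t₁ p) p.1).1
              (γ (s + t₁ p) p.2).1) ((γ (s + t₁ p) p.1).2, (γ (s + t₁ p) p.2).2)).2
        else 0) := by
    intro p hp
    rw [hR] at hp
    obtain ⟨-, hne, hex, hp1, hp2⟩ := Finset.mem_filter.1 hp
    -- the first near-contact time `t₁ p ∈ (0, t - s]` is a contact time of the free flights
    obtain ⟨δ, hδ, hsep⟩ := RateFloorWindowPreemption.exists_sep_window h hε2 s hne
    have hcont : Continuous fun u : ℝ => ‖(Torus.geometry (Fin 3)).sepVec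
        (freeFlight (Torus.geometry (Fin 3)) u (γ s) p.1).1
        (freeFlight (Torus.geometry (Fin 3)) u (γ s) p.2).1‖ := by
      simpa only [Function.comp_def] using
        (hG.continuous_norm_sepVec_config p.1 p.2).comp (hG.continuous_freeFlight (γ s))
    have hτ : t₁ p ∈ Set.Ioc 0 (t - s) ∧ ‖(Torus.geometry (Fin 3)).sepVec
        (freeFlight (Torus.geometry (Fin 3)) (t₁ p) (γ s) p.1).1
        (freeFlight (Torus.geometry (Fin 3)) (t₁ p) (γ s) p.2).1‖ = ε :=
      first_contact hcont hδ hsep hex (ht₁ p)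
    -- positions at `s + t₁ p` are the free-flight positions, in contact
    have hpos1 := apply_fst_eq_freeFlight_of_not_participates h hτ.1.1 hp1
    have hpos2 := apply_fst_eq_freeFlight_of_not_participates h hτ.1.1 hp2
    have hnorm : ‖(Torus.geometry (Fin 3)).sepVec (γ (s + t₁ p) p.1).1
        (γ (s + t₁ p) p.2).1‖ = ε := by
      rw [hpos1, hpos2]
      exact hτ.2
    -- the antecedent S6a: the reflected current velocities are the window-start velocities
    have hrefl := (hS6a N ε γ h hε hε2 s (s + t₁ p) p.1 p.2 (by linarith [hτ.1.1]) hne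
      (fun u hu hmem => hp1 u hu (mem_collisionTimesOf.1 hmem))
      (fun u hu hmem => hp2 u hu (mem_collisionTimesOf.1 hmem))
      (by rw [add_sub_cancel_left]; exact hτ.2)).2
    refine ⟨⟨?_, by linarith [hτ.1.1], by linarith [hτ.1.2]⟩, ?_⟩
    · exact mem_collisionTimes.2 ⟨p.1, p.2, hne, mem_contactSet.2 ⟨h.mem _, hnorm⟩⟩
    · rw [if_pos (And.intro hne hnorm), hrefl, hpos1, hpos2]
  -- (3) summation: distinct pairs give distinct indices, the other summands are nonnegative
  have hfin : (collisionTimes (Torus.geometry (Fin 3)) ε γ ∩ Set.Ioc s t).Finite :=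
    h.finite_collisionTimes_inter_of_subset_Icc Set.Ioc_subset_Icc_self
  rw [finsum_mem_eq_finite_toFinset_sum _ hfin]
  refine sum_le_sum_sum_sum R hfin.toFinset ?_ (fun p => s + t₁ p) ?_ ?_
  · intro v i j
    split_ifs
    · exact hF _ _ _ _ _
    · exact le_rfl
  · exact fun p hp => hfin.mem_toFinset.2 (key p hp).1
  · exact fun p hp => (key p hp).2

end RateFloorMarkedTransfer

end Summit.AtomisticToContinuum.HydrodynamicLimit.Theorems

end
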